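import Summits.Ventures.HodgeRepro2.T5InertSatakeTransform
import Summits.Ventures.HodgeRepro2.T5InertDegreeToy

/-!
# The Satake transform of `T₁` on the record's local fields and on `ℚ(ζ₃)` at `2`
(cell pub-hodge-repro2, seat p3)

Tier-5 N3 support — T5-SATAKE-KERNEL-p3.md row 12 evaluated where the record lives. File 213 proves
`S(T₁) = q² X + (q − 1) + q² X⁻¹` for the abstract inert-place package under the trace lift `htr` and the
non-triviality `hnt` of the residue involution. On Mathlib's completions `K_v ⊆ L_w` of the record's number fields
both are theorems (files 206 / 204) and `q = N(v)` (file 207), so: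

* `exists_residueStar_ne_adicCompletion` / `exists_trace_lift_adicCompletion` — `hnt` and `htr` on the completions;
* **`satakeTransformOne_eq_adicCompletion`** — `S(T₁) = N(v)² X + (N(v) − 1) + N(v)² X⁻¹` at every inert place
  (`e(w/v) = 1`, `[L_w : K_v] = 2`, `σ ≠ 1`, `u ∈ O_{K_v}ˣ`);
* **`satakeTransformOne_eq_toy`** — on seat p4's place `ℚ(ζ₃)/ℚ` at `2` (`N(v₂) = 2`):
  `S(T₁) = 4 X + 1 + 4 X⁻¹`.

Mathlib + this seat's files 213 / 208 and their imports; no display; no device.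
§8(d): uses an L-value-free non-vanishing device: NO.
-/

namespace Summit.Ventures.HodgeRepro2.T5InertSatakeTransformCompletion

open IsDedekindDomain HeightOneSpectrum NumberField
open Summit.Ventures.HodgeRepro2.T5GaloisCartanThree Summit.Ventures.HodgeRepro2.T5InertUnipotentResidue
  Summit.Ventures.HodgeRepro2.T5InertResidueInvolution Summit.Ventures.HodgeRepro2.T5InertTraceLift
  Summit.Ventures.HodgeRepro2.T5InertDegreeGalois Summit.Ventures.HodgeRepro2.T5InertDegreeCompletion
  Summit.Ventures.HodgeRepro2.T5InertPlaceCompletion Summit.Ventures.HodgeRepro2.T5InertDegreeAdicCompletion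
  Summit.Ventures.HodgeRepro2.T5InertSatakeTransform

section Completion

variable {K : Type*} [Field K] [NumberField K] (v : HeightOneSpectrum (RingOfIntegers K))
  {L : Type*} [Field L] [NumberField L] [Algebra K L] (w : HeightOneSpectrum (RingOfIntegers L))
  [w.asIdeal.LiesOver v.asIdeal]
  [IsDiscreteValuationRing (integralClosure (v.adicCompletionIntegers K) (w.adicCompletion L))]
  [Finite (IsLocalRing.ResidueField (integralClosure (v.adicCompletionIntegers K) (w.adicCompletion L)))]
  [IsFractionRing (integralClosure (v.adicCompletionIntegers K) (w.adicCompletion L)) (w.adicCompletion L)]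
  [StarRing (w.adicCompletion L)]
  (σ : (w.adicCompletion L) ≃ₐ[v.adicCompletion K] (w.adicCompletion L))
  (hst : ∀ x : w.adicCompletion L, star x = σ x)
  (he : v.asIdeal.ramificationIdx' w.asIdeal = 1)
  (h2 : Module.finrank (v.adicCompletion K) (w.adicCompletion L) = 2) (hσ : σ ≠ 1)
  {ϖ : v.adicCompletionIntegers K} (hϖ : Irreducible ϖ)
  (hinert : Irreducible (algebraMap (v.adicCompletionIntegers K) (w.adicCompletionIntegers L) ϖ))

omit [Finite (IsLocalRing.ResidueField (integralClosure (v.adicCompletionIntegers K) (w.adicCompletion L)))] in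
include hst he h2 hσ hϖ hinert in
/-- **`hnt` on the record's local fields**: the residue involution of `𝒪_{E_v}` moves some class. -/
theorem exists_residueStar_ne_adicCompletion :
    ∃ t : IsLocalRing.ResidueField (integralClosure (v.adicCompletionIntegers K) (w.adicCompletion L)),
      residueStar (hstar_of_star_eq σ hst)
        (irreducible_uniformiser (map_maximalIdeal_integralClosure_eq_of_irreducible v w hϖ hinert) hϖ)
        (star_algebraMap_of_star_eq σ hst ϖ) t ≠ t :=
  exists_residueStar_ne (hstar_of_star_eq σ hst)
    (irreducible_uniformiser (map_maximalIdeal_integralClosure_eq_of_irreducible v w hϖ hinert) hϖ)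
    (star_algebraMap_of_star_eq σ hst ϖ)
    (hnt_of_residueConjNontrivial σ hst (residueConjNontrivial_adicCompletion v w he h2 σ hσ hinert))

include hst he h2 hσ hϖ hinert in
/-- **`htr` on the record's local fields**: the trace lift `e + ē = 1` exists in `𝒪_{E_v}`. -/
theorem exists_trace_lift_adicCompletion :
    ∃ e : integralClosure (v.adicCompletionIntegers K) (w.adicCompletion L),
      algebraMap (integralClosure (v.adicCompletionIntegers K) (w.adicCompletion L)) (w.adicCompletion L) e +
        star (algebraMap (integralClosure (v.adicCompletionIntegers K) (w.adicCompletion L))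
          (w.adicCompletion L) e) = 1 :=
  exists_trace_lift (hstar_of_star_eq σ hst)
    (irreducible_uniformiser (map_maximalIdeal_integralClosure_eq_of_irreducible v w hϖ hinert) hϖ)
    (star_algebraMap_of_star_eq σ hst ϖ) (exists_residueStar_ne_adicCompletion v w σ hst he h2 hσ hϖ hinert)

include hst he h2 hσ hϖ hinert in
/-- **`S(T₁) = N(v)² X + (N(v) − 1) + N(v)² X⁻¹` on the record's local fields.** -/
theorem satakeTransformOne_eq_adicCompletion (u : (v.adicCompletionIntegers K)ˣ) (m : ℤ) :
    satakeTransformOne (hstar_of_star_eq σ hst)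
        (algebraMap (v.adicCompletionIntegers K) (w.adicCompletion L) (u : v.adicCompletionIntegers K))
        (isInteger_algebraMap_unit_inv u)
        (irreducible_uniformiser (map_maximalIdeal_integralClosure_eq_of_irreducible v w hϖ hinert) hϖ)
        (star_algebraMap_of_star_eq σ hst ϖ) m =
      (Ideal.absNorm v.asIdeal : ℚ) ^ 2 * (if m = 1 then 1 else 0) +
        ((Ideal.absNorm v.asIdeal : ℚ) - 1) * (if m = 0 then 1 else 0) +
        (Ideal.absNorm v.asIdeal : ℚ) ^ 2 * (if m = -1 then 1 else 0) := by
  rw [satakeTransformOne_eq (hstar_of_star_eq σ hst)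
    (algebraMap (v.adicCompletionIntegers K) (w.adicCompletion L) (u : v.adicCompletionIntegers K))
    (star_algebraMap_of_star_eq σ hst (u : v.adicCompletionIntegers K))
    (algebraMap_unit_ne_zero (F := v.adicCompletion K) u) (isInteger_algebraMap (u : v.adicCompletionIntegers K))
    (isInteger_algebraMap_unit_inv u)
    (irreducible_uniformiser (map_maximalIdeal_integralClosure_eq_of_irreducible v w hϖ hinert) hϖ)
    (star_algebraMap_of_star_eq σ hst ϖ) (exists_trace_lift_adicCompletion v w σ hst he h2 hσ hϖ hinert)
    (exists_residueStar_ne_adicCompletion v w σ hst he h2 hσ hϖ hinert) m,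
    card_traceZero_eq_absNorm v w σ hst he h2 hσ hϖ hinert]

end Completion

section Toy

open Summit.Ventures.HodgeRepro2.T5GaussianField Summit.Ventures.HodgeRepro2.T5EisensteinField
  Summit.Ventures.HodgeRepro2.T5EisensteinInertPlace Summit.Ventures.HodgeRepro2.T5GaussianPlace
  Summit.Ventures.HodgeRepro2.T5InertDegreeToy

variable (w : HeightOneSpectrum (RingOfIntegers L₃)) [w.asIdeal.LiesOver v₂.asIdeal]
  [IsDiscreteValuationRing (integralClosure (v₂.adicCompletionIntegers ℚ) (w.adicCompletion L₃))]
  [Finite (IsLocalRing.ResidueField (integralClosure (v₂.adicCompletionIntegers ℚ) (w.adicCompletion L₃)))]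
  [IsFractionRing (integralClosure (v₂.adicCompletionIntegers ℚ) (w.adicCompletion L₃)) (w.adicCompletion L₃)]
  [StarRing (w.adicCompletion L₃)]
  (σ : (w.adicCompletion L₃) ≃ₐ[v₂.adicCompletion ℚ] (w.adicCompletion L₃))
  (hst : ∀ x : w.adicCompletion L₃, star x = σ x) (hσ : σ ≠ 1)

include hst hσ in
/-- **`S(T₁) = 4 X + 1 + 4 X⁻¹` at the place `2` of `ℚ(ζ₃)`** (`q = N(v₂) = 2`). -/
theorem satakeTransformOne_eq_toy (u : (v₂.adicCompletionIntegers ℚ)ˣ) (m : ℤ) :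
    satakeTransformOne (hstar_of_star_eq σ hst)
        (algebraMap (v₂.adicCompletionIntegers ℚ) (w.adicCompletion L₃) (u : v₂.adicCompletionIntegers ℚ))
        (isInteger_algebraMap_unit_inv u)
        (irreducible_uniformiser (map_maximalIdeal_integralClosure_eq_of_irreducible v₂ w irreducible_two
          (irreducible_algebraMap_two w)) irreducible_two)
        (star_algebraMap_of_star_eq σ hst (2 : v₂.adicCompletionIntegers ℚ)) m =
      4 * (if m = 1 then 1 else 0) + (if m = 0 then 1 else 0) + 4 * (if m = -1 then 1 else 0) := by
  rw [satakeTransformOne_eq_adicCompletion v₂ w σ hst (ramificationIdx'_eq_one w) (finrank_eq_two w) hσ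
    irreducible_two (irreducible_algebraMap_two w) u m, absNorm_v₂]
  norm_num

end Toy

end Summit.Ventures.HodgeRepro2.T5InertSatakeTransformCompletion
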